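import Mathlib
import HarnessLib

/-!
# Crux `NoZenoR` (stmt-ResolutionOfSingularities-19943), β layer, slot 5 seam2 (m3) disjunct 2 — (S2a) POINT COUNT:
# a separable residue jump of `≥ 2` downstairs gives `≥ 2` points upstairs over EVERY point of the splitting base change

Route `ResolutionOfSingularities/HomologicalConductor`, crux chain W4.4.  OURS (cell res-hironaka; object (S2a) «POINT
COUNT, ring half» of planner res-L0-w44-plan-1 RULING (ρ53e) 2026-08-27T21:01:09Z, hand res-D-pv-039; consumer: the scheme
wrapper of res-L0-w44-stub-4 after (S1) `…NoZenoSelfNodeSepJump`).  Pure field / tensor-product algebra over Mathlib, in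
the currency of res-L0-w44-stub-2's `…NoZenoSplitCountSplitting` / `…NoZenoPullbackResidueField` (splitting hypothesis
`∀ x : separableClosure κ F, ((minpoly κ x).map (algebraMap κ k')).Splits`, separable degree `Module.finrank K
(separableClosure K F)`); AI-written, weaker than expert review; nothing here is a statement of the manuscript under
review (Hironaka 2017) and no Theses declaration is asserted.  Def-free, fact-free, `--supports 19943 --as helper`.

Setting (all fields): `κ` (residue field of the germ) `→ K` (= `κ(z)`, ALGEBRAIC over `κ`) `→ F` (= `κ(y)`, the
residue field of the point `y` of the node blow-up over the self-node `z`); `k'` (= residue field of the splitting base,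
any extension of `κ`); `Ω₁` ANY field receiving `K` and `k'` compatibly over `κ` (= the residue field `κ(z₁)` of a point
`z₁` of `X_f` over `z`: `K → κ(z₁)` through `σ.residueFieldMap`, `k' → κ(z₁)` through `π_f.residueFieldMap`).

* `mem_range_of_isSeparable_of_pow_mem` — an element separable over `M` some `q^n`-th power of which lies in `M` lies
  in `M` (`separableClosure ⊓ perfectClosure = ⊥`);
* `exists_isSeparable_pow` — an algebraic element has a `q^n`-th power separable over the base (separable contraction of
  its minimal polynomial);
* **`splits_map_minpoly_of_splits`** — if `k'` splits the separable closure of `κ` in `F`, then for every `β ∈ F`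
  separable over `K` the minimal polynomial `minpoly K β` SPLITS IN `Ω₁`: a root `a` (in an algebraic closure of `Ω₁`)
  is separable over `Ω₁`, and `a^{qⁿ}` is a root of the minimal polynomial over `κ` of the `κ`-separable element
  `β^{qⁿ}`, hence lies in (the image of) `k' ⊆ Ω₁`;
* `exists_algHom_ne` — so `2 ≤ [F : K]_s` gives two distinct `K`-embeddings `separableClosure K F → Ω₁`
  (`AlgHom.card_of_splits`);
* `eq_of_ker_lift_eq` — `Ω₁`-algebra characters of `Ω₁ ⊗_K E` with equal kernels are equal;
  `mem_minimalPrimes_of_isPrime` — every prime of `Ω₁ ⊗_K E` (`E/K` finite) is minimal;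
* **`exists_two_primes_left`**, **`exists_two_primes`**, `exists_primeSpectrum_ne` — hence `Ω₁ ⊗_K F` (resp.
  `F ⊗_K Ω₁`) has two distinct prime ideals: «the fibre `Spec (F ⊗_K κ(z₁))` has at least two points» — the (S2a)
  statement of (ρ53e);
* `exists_two_primes_of_ringHom` — the same with the structure maps as explicit ring homomorphisms (the shape in which
  scheme-side residue-field maps `(… .residueFieldMap _).hom.toAlgebra` arrive).

References: J. Lipman, Publ. Math. IHÉS 36 (1969), §16 (16.1), (16.5), pp. 231–235 (base change of the exceptional
fibre to a larger residue field; context only) [`Lipman1969`]; The Stacks Project, Tags 030K, 09HE, 00FK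
[`StacksProject`].
-/

noncomputable section

-- single-problem summit: the doubled namespace component `ResolutionOfSingularities` is forced
set_option linter.dupNamespace false

namespace Summit.ResolutionOfSingularities.ResolutionOfSingularities.Theorems.NoZeno.ExcCount

open TensorProduct Polynomial IntermediateField

namespace SplitFibre

/-! ## §1 Two field-theoretic lemmas -/

section FieldLemmas

variable {M Ω : Type*} [Field M] [Field Ω] [Algebra M Ω]

/-- An element of an extension `Ω/M` which is separable over `M` and has some `q^n`-th power in `M` (`q` the
exponential characteristic) lies in `M`: it is in `separableClosure M Ω ⊓ perfectClosure M Ω = ⊥`.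
[cite: StacksProject, Tag 030K] -/
theorem mem_range_of_isSeparable_of_pow_mem (q : ℕ) [ExpChar M q] {a : Ω} (hsep : IsSeparable M a) {n : ℕ}
    (hpow : a ^ q ^ n ∈ (algebraMap M Ω).range) : a ∈ (algebraMap M Ω).range := by
  have h1 : a ∈ separableClosure M Ω := mem_separableClosure_iff.2 hsep
  have h2 : a ∈ perfectClosure M Ω := (mem_perfectClosure_iff_pow_mem q).2 ⟨n, hpow⟩
  have h3 : a ∈ separableClosure M Ω ⊓ perfectClosure M Ω := ⟨h1, h2⟩
  rw [separableClosure_inf_perfectClosure, IntermediateField.mem_bot] at h3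
  obtain ⟨m, hm⟩ := h3
  exact ⟨m, hm⟩

/-- An element integral over `M` has a `q^n`-th power which is SEPARABLE over `M` (`q` the exponential characteristic):
contract its minimal polynomial to a separable polynomial. [cite: StacksProject, Tag 09HE] -/
theorem exists_isSeparable_pow (q : ℕ) [ExpChar M q] {β : Ω} (hβ : IsIntegral M β) :
    ∃ n : ℕ, IsSeparable M (β ^ q ^ n) := by
  obtain ⟨g, hgsep, n, hgexp⟩ := (minpoly.irreducible hβ).hasSeparableContraction q
  refine ⟨n, ?_⟩
  have hroot : aeval (β ^ q ^ n) g = 0 := by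
    rw [← expand_aeval, hgexp, minpoly.aeval]
  exact hgsep.of_dvd (minpoly.dvd M _ hroot)

end FieldLemmas

/-! ## §2 Splitting of `K`-minimal polynomials in `Ω₁` -/

section Splitting

variable (κ K F k' Ω₁ : Type*) [Field κ] [Field K] [Field F] [Field k'] [Field Ω₁]
  [Algebra κ K] [Algebra K F] [Algebra κ F] [IsScalarTower κ K F]
  [Algebra κ k'] [Algebra κ Ω₁] [Algebra K Ω₁] [Algebra k' Ω₁] [IsScalarTower κ K Ω₁] [IsScalarTower κ k' Ω₁]

/-- **Splitting of `K`-minimal polynomials in `Ω₁`.**  `κ → K → F` fields with `K/κ` algebraic, `k'/κ` splitting the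
separable closure of `κ` in `F`, `Ω₁` a field over `K` and `k'` compatibly over `κ`: for every `β ∈ F` separable over
`K`, `minpoly K β` splits in `Ω₁`.  Proof: in an algebraic closure `Ω̄` of `Ω₁` a root `a` is separable over `Ω₁`
(`minpoly K β` is separable); `β` is algebraic over `κ`, so `β^{qⁿ}` is `κ`-separable for some `n`, its `κ`-minimal
polynomial splits in `k'`, and `a^{qⁿ}` is one of its roots, hence lies in `k' ⊆ Ω₁`; so `a ∈ Ω₁`
(`mem_range_of_isSeparable_of_pow_mem`). [this work] -/
theorem splits_map_minpoly_of_splits [Algebra.IsAlgebraic κ K]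
    (hsplit : ∀ x : separableClosure κ F, ((minpoly κ x).map (algebraMap κ k')).Splits)
    {β : F} (hβ : IsSeparable K β) : ((minpoly K β).map (algebraMap K Ω₁)).Splits := by
  -- exponential characteristic
  let q := ringExpChar κ
  haveI hqκ : ExpChar κ q := inferInstance
  haveI hqΩ : ExpChar Ω₁ q := expChar_of_injective_algebraMap (algebraMap κ Ω₁).injective q
  -- `β` is integral over `κ`
  haveI : Algebra.IsIntegral κ K := Algebra.isAlgebraic_iff_isIntegral.mp inferInstance
  have hβK : IsIntegral K β := hβ.isIntegral
  have hβκ : IsIntegral κ β := isIntegral_trans β hβK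
  -- a `κ`-separable power `γ = β ^ q ^ n`
  obtain ⟨n, hγsep⟩ := exists_isSeparable_pow (M := κ) q hβκ
  set γ : F := β ^ q ^ n with hγdef
  have hγmem : γ ∈ separableClosure κ F := mem_separableClosure_iff.2 hγsep
  -- its minimal polynomial splits in `k'`
  have hγsplit : ((minpoly κ γ).map (algebraMap κ k')).Splits := by
    have hmin : minpoly κ (⟨γ, hγmem⟩ : separableClosure κ F) = minpoly κ γ :=
      (minpoly.algHom_eq (separableClosure κ F).val Subtype.val_injective ⟨γ, hγmem⟩).symm
    rw [← hmin]
    exact hsplit ⟨γ, hγmem⟩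
  have hγne : minpoly κ γ ≠ 0 := minpoly.ne_zero hγsep.isIntegral
  -- work in an algebraic closure of `Ω₁`
  let Ωb := AlgebraicClosure Ω₁
  refine Polynomial.Splits.of_splits_map (algebraMap Ω₁ Ωb) ?_ ?_
  · rw [Polynomial.map_map, ← IsScalarTower.algebraMap_eq]
    exact IsAlgClosed.splits _
  · intro a ha
    rw [Polynomial.map_map, ← IsScalarTower.algebraMap_eq] at ha
    -- `a` is a root of `minpoly K β` in `Ω̄`
    have ha' : aeval a (minpoly K β) = 0 := (Polynomial.mem_aroots.1 ha).2
    -- (1) `a` is separable over `Ω₁`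
    have hasep : IsSeparable Ω₁ a := by
      have hdvd : minpoly Ω₁ a ∣ (minpoly K β).map (algebraMap K Ω₁) :=
        minpoly.dvd Ω₁ a (by rw [aeval_map_algebraMap]; exact ha')
      exact Polynomial.Separable.of_dvd (Polynomial.separable_map _ |>.2 hβ) hdvd
    -- (2) `a ^ q ^ n` is a root of `minpoly κ γ`
    have hκβ : aeval a (minpoly κ β) = 0 := by
      obtain ⟨r, hr⟩ := minpoly.dvd_map_of_isScalarTower κ K β
      rw [← aeval_map_algebraMap K, hr, map_mul, ha', zero_mul]
    have hexp : minpoly κ β ∣ expand κ (q ^ n) (minpoly κ γ) :=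
      minpoly.dvd κ β (by rw [expand_aeval, minpoly.aeval])
    have hγroot : aeval (a ^ q ^ n) (minpoly κ γ) = 0 := by
      obtain ⟨r, hr⟩ := hexp
      rw [← expand_aeval, hr, map_mul, hκβ, zero_mul]
    -- (3) hence `a ^ q ^ n` lies in (the image of) `k'`, so in (the image of) `Ω₁`
    have hpow_k : a ^ q ^ n ∈ (algebraMap k' Ωb).range := by
      refine Polynomial.Splits.mem_range_of_isRoot hγsplit ((Polynomial.map_ne_zero_iff
        (algebraMap κ k').injective).2 hγne) ?_
      rw [Polynomial.map_map, ← IsScalarTower.algebraMap_eq, Polynomial.IsRoot.def, Polynomial.eval_map,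
        ← Polynomial.aeval_def]
      exact hγroot
    have hpow : a ^ q ^ n ∈ (algebraMap Ω₁ Ωb).range := by
      obtain ⟨c, hc⟩ := hpow_k
      refine ⟨algebraMap k' Ω₁ c, ?_⟩
      rw [← IsScalarTower.algebraMap_apply]
      exact hc
    -- (4) conclude
    exact mem_range_of_isSeparable_of_pow_mem q hasep hpow

/-- **Two distinct `K`-embeddings of the separable closure.**  Under the hypotheses of `splits_map_minpoly_of_splits`
and `2 ≤ [F : K]_s := Module.finrank K (separableClosure K F)`, there are two distinct `K`-algebra maps
`separableClosure K F → Ω₁` (there are exactly `[F : K]_s` of them, `AlgHom.card_of_splits`). [this work] -/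
theorem exists_algHom_ne [Algebra.IsAlgebraic κ K]
    (hsplit : ∀ x : separableClosure κ F, ((minpoly κ x).map (algebraMap κ k')).Splits)
    (h2 : 2 ≤ Module.finrank K (separableClosure K F)) :
    ∃ ψ₁ ψ₂ : separableClosure K F →ₐ[K] Ω₁, ψ₁ ≠ ψ₂ := by
  haveI : FiniteDimensional K (separableClosure K F) := Module.finite_of_finrank_pos (by omega)
  have hL : ∀ x : separableClosure K F, ((minpoly K x).map (algebraMap K Ω₁)).Splits := by
    intro x
    have hmin : minpoly K x = minpoly K (x : F) :=
      (minpoly.algHom_eq (separableClosure K F).val Subtype.val_injective x).symm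
    rw [hmin]
    exact splits_map_minpoly_of_splits κ K F k' Ω₁ hsplit (mem_separableClosure_iff.1 x.2)
  have hcard : Fintype.card (separableClosure K F →ₐ[K] Ω₁) = Module.finrank K (separableClosure K F) :=
    AlgHom.card_of_splits K (separableClosure K F) Ω₁ hL
  exact Fintype.exists_pair_of_one_lt_card (by omega)

end Splitting

/-! ## §3 Two points in the fibre -/

section Fibre

variable {K Ω₁ : Type*} [Field K] [Field Ω₁] [Algebra K Ω₁] {E : Type*} [Field E] [Algebra K E]

/-- The `Ω₁`-algebra character `Ω₁ ⊗_K E → Ω₁`, `w ⊗ e ↦ w · ψ e`, of a `K`-embedding `ψ : E → Ω₁`. [folklore] -/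
private theorem lift_tmul' (ψ : E →ₐ[K] Ω₁) (w : Ω₁) (e : E) :
    Algebra.TensorProduct.lift (AlgHom.id Ω₁ Ω₁) ψ (fun _ _ => Commute.all _ _) (w ⊗ₜ[K] e) = w * ψ e :=
  Algebra.TensorProduct.lift_tmul _ _ _ _ _

/-- **Characters with equal kernels are equal**: two `Ω₁`-algebra maps `Ω₁ ⊗_K E → Ω₁` induced by `K`-embeddings
`ψ₁, ψ₂ : E → Ω₁` with the same kernel come from the same embedding. [folklore] -/
theorem eq_of_ker_lift_eq (ψ₁ ψ₂ : E →ₐ[K] Ω₁)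
    (h : RingHom.ker (Algebra.TensorProduct.lift (AlgHom.id Ω₁ Ω₁) ψ₁ (fun _ _ => Commute.all _ _)) =
      RingHom.ker (Algebra.TensorProduct.lift (AlgHom.id Ω₁ Ω₁) ψ₂ (fun _ _ => Commute.all _ _))) :
    ψ₁ = ψ₂ := by
  set Ψ₁ := Algebra.TensorProduct.lift (AlgHom.id Ω₁ Ω₁) ψ₁ (fun _ _ => Commute.all _ _) with hΨ₁
  set Ψ₂ := Algebra.TensorProduct.lift (AlgHom.id Ω₁ Ω₁) ψ₂ (fun _ _ => Commute.all _ _) with hΨ₂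
  have key : ∀ t : Ω₁ ⊗[K] E, Ψ₂ t = Ψ₁ t := by
    intro t
    have hmem : t - algebraMap Ω₁ (Ω₁ ⊗[K] E) (Ψ₁ t) ∈ RingHom.ker Ψ₁ := by
      rw [RingHom.mem_ker, map_sub, AlgHom.commutes, Algebra.algebraMap_self, RingHom.id_apply, sub_self]
    rw [h, RingHom.mem_ker, map_sub, AlgHom.commutes, Algebra.algebraMap_self, RingHom.id_apply, sub_eq_zero] at hmem
    exact hmem
  ext e
  have h1 : Ψ₁ ((1 : Ω₁) ⊗ₜ[K] e) = ψ₁ e := by rw [hΨ₁, lift_tmul', one_mul]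
  have h2 : Ψ₂ ((1 : Ω₁) ⊗ₜ[K] e) = ψ₂ e := by rw [hΨ₂, lift_tmul', one_mul]
  rw [← h1, ← h2, key]

/-- Every prime of `Ω₁ ⊗_K E`, `E/K` finite, is a MINIMAL prime (the ring is finite over the field `Ω₁`, so its
primes are maximal). [folklore] -/
theorem mem_minimalPrimes_of_isPrime [FiniteDimensional K E] (p : Ideal (Ω₁ ⊗[K] E)) [hp : p.IsPrime] :
    p ∈ minimalPrimes (Ω₁ ⊗[K] E) := by
  haveI : Algebra.IsIntegral Ω₁ (Ω₁ ⊗[K] E) := Algebra.IsIntegral.of_finite Ω₁ _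
  -- every prime is maximal
  have hmax : ∀ q : Ideal (Ω₁ ⊗[K] E), q.IsPrime → q.IsMaximal := by
    intro q hq
    refine Ideal.isMaximal_of_isIntegral_of_isMaximal_comap (R := Ω₁) q ?_
    have hne : (q.comap (algebraMap Ω₁ (Ω₁ ⊗[K] E))) ≠ ⊤ := (Ideal.comap_isPrime _ q).ne_top
    rcases Ideal.eq_bot_or_top (q.comap (algebraMap Ω₁ (Ω₁ ⊗[K] E))) with hbot | htop
    · rw [hbot]; exact Ideal.bot_isMaximal
    · exact absurd htop hne
  refine ⟨⟨hp, bot_le⟩, fun q hq hqp => ?_⟩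
  haveI := hq.1
  exact le_of_eq ((hmax q hq.1).eq_of_le hp.ne_top hqp).symm

variable (κ K F k' Ω₁ : Type*) [Field κ] [Field K] [Field F] [Field k'] [Field Ω₁]
  [Algebra κ K] [Algebra K F] [Algebra κ F] [IsScalarTower κ K F]
  [Algebra κ k'] [Algebra κ Ω₁] [Algebra K Ω₁] [Algebra k' Ω₁] [IsScalarTower κ K Ω₁] [IsScalarTower κ k' Ω₁]

/-- **(S2a), `Ω₁` on the left: `Spec (Ω₁ ⊗_K F)` has at least two points.**  `κ → K → F` fields, `K/κ` algebraic,
`2 ≤ [F : K]_s`, `k'/κ` splitting the separable closure of `κ` in `F`, `Ω₁` a field over `K` and `k'` compatibly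
over `κ`: `Ω₁ ⊗_K F` has two distinct prime ideals.  Proof: two distinct `K`-embeddings `ψᵢ` of
`E := separableClosure K F` into `Ω₁` (`exists_algHom_ne`) give two `Ω₁`-characters of `Ω₁ ⊗_K E` with distinct
(maximal, minimal) kernels; lift them along the injection `Ω₁ ⊗_K E → Ω₁ ⊗_K F` (Stacks 00FK). [this work] -/
theorem exists_two_primes_left [Algebra.IsAlgebraic κ K]
    (hsplit : ∀ x : separableClosure κ F, ((minpoly κ x).map (algebraMap κ k')).Splits)
    (h2 : 2 ≤ Module.finrank K (separableClosure K F)) :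
    ∃ P Q : Ideal (Ω₁ ⊗[K] F), P.IsPrime ∧ Q.IsPrime ∧ P ≠ Q := by
  set E := separableClosure K F
  haveI : FiniteDimensional K E := Module.finite_of_finrank_pos (by omega)
  obtain ⟨ψ₁, ψ₂, hne⟩ := exists_algHom_ne κ K F k' Ω₁ hsplit h2
  -- the two characters and their kernels
  let Ψ : (E →ₐ[K] Ω₁) → (Ω₁ ⊗[K] E →ₐ[Ω₁] Ω₁) := fun ψ =>
    Algebra.TensorProduct.lift (AlgHom.id Ω₁ Ω₁) ψ (fun _ _ => Commute.all _ _)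
  haveI hprime₁ : (RingHom.ker (Ψ ψ₁)).IsPrime := RingHom.ker_isPrime _
  haveI hprime₂ : (RingHom.ker (Ψ ψ₂)).IsPrime := RingHom.ker_isPrime _
  have hker_ne : RingHom.ker (Ψ ψ₁) ≠ RingHom.ker (Ψ ψ₂) := fun h => hne (eq_of_ker_lift_eq ψ₁ ψ₂ h)
  -- the injection `φ : Ω₁ ⊗_K E → Ω₁ ⊗_K F`
  let φ : Ω₁ ⊗[K] E →ₐ[K] Ω₁ ⊗[K] F := Algebra.TensorProduct.map (AlgHom.id K Ω₁) E.val
  have hφ : Function.Injective φ := by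
    change Function.Injective φ.toLinearMap
    rw [Algebra.TensorProduct.toLinearMap_map]
    exact TensorProduct.map_injective_of_flat_flat _ _ (fun _ _ h => h) Subtype.val_injective
  -- lift the two minimal primes
  have hmin₁ : (RingHom.ker (Ψ ψ₁) : Ideal (Ω₁ ⊗[K] E)) ∈ minimalPrimes (Ω₁ ⊗[K] E) :=
    mem_minimalPrimes_of_isPrime _
  have hmin₂ : (RingHom.ker (Ψ ψ₂) : Ideal (Ω₁ ⊗[K] E)) ∈ minimalPrimes (Ω₁ ⊗[K] E) :=
    mem_minimalPrimes_of_isPrime _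
  obtain ⟨P, hP, hPc⟩ := Ideal.exists_comap_eq_of_mem_minimalPrimes_of_injective (f := φ.toRingHom) hφ _ hmin₁
  obtain ⟨Q, hQ, hQc⟩ := Ideal.exists_comap_eq_of_mem_minimalPrimes_of_injective (f := φ.toRingHom) hφ _ hmin₂
  refine ⟨P, Q, hP, hQ, fun hPQ => hker_ne ?_⟩
  rw [← hPc, ← hQc, hPQ]

/-- **(S2a) POINT COUNT: `Spec (F ⊗_K Ω₁)` has at least two points.**  `κ → K → F` fields with `K/κ` algebraic and
`2 ≤ Module.finrank K (separableClosure K F)`; `k'/κ` splitting the separable closure of `κ` in `F`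
(`∀ x : separableClosure κ F, ((minpoly κ x).map (algebraMap κ k')).Splits`); `Ω₁` any field over `K` and over `k'`
compatibly over `κ` — e.g. the residue field `κ(z₁)` of a point `z₁` of `Spec (K ⊗_κ k')`, or of a point `z₁` of `X_f`
over `z` with `K = κ(z)`.  Then the fibre ring `F ⊗_K Ω₁` has two distinct prime ideals (res-L0-w44-plan-1 (ρ53e)
(S2a): «for every point `z₁` the fibre `Spec (F ⊗_K κ(z₁))` has `≥ 2` points»). [this work] -/
theorem exists_two_primes [Algebra.IsAlgebraic κ K]
    (hsplit : ∀ x : separableClosure κ F, ((minpoly κ x).map (algebraMap κ k')).Splits)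
    (h2 : 2 ≤ Module.finrank K (separableClosure K F)) :
    ∃ P Q : Ideal (F ⊗[K] Ω₁), P.IsPrime ∧ Q.IsPrime ∧ P ≠ Q := by
  obtain ⟨P, Q, hP, hQ, hne⟩ := exists_two_primes_left κ K F k' Ω₁ hsplit h2
  let e : F ⊗[K] Ω₁ ≃ₐ[K] Ω₁ ⊗[K] F := Algebra.TensorProduct.comm K F Ω₁
  refine ⟨P.comap e.toRingHom, Q.comap e.toRingHom, Ideal.comap_isPrime _ _, Ideal.comap_isPrime _ _, fun h => hne ?_⟩
  exact Ideal.comap_injective_of_surjective e.toRingHom e.surjective h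

/-- The same as two distinct points of the prime spectrum. [this work] -/
theorem exists_primeSpectrum_ne [Algebra.IsAlgebraic κ K]
    (hsplit : ∀ x : separableClosure κ F, ((minpoly κ x).map (algebraMap κ k')).Splits)
    (h2 : 2 ≤ Module.finrank K (separableClosure K F)) :
    ∃ p q : PrimeSpectrum (F ⊗[K] Ω₁), p ≠ q := by
  obtain ⟨P, Q, hP, hQ, hne⟩ := exists_two_primes κ K F k' Ω₁ hsplit h2
  exact ⟨⟨P, hP⟩, ⟨Q, hQ⟩, fun h => hne (congrArg PrimeSpectrum.asIdeal h)⟩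

end Fibre

/-! ## §4 Ring-hom form (structure maps explicit) -/

section RingHomForm

/-- **(S2a) with explicit structure maps.**  Fields `κ, K, F, k', Ω₁` and ring homomorphisms `iK : κ → K`,
`iF : K → F`, `i₀ : κ → F` with `i₀ = iF ∘ iK` (pointwise), `ik : κ → k'`, `jK : K → Ω₁`, `jk : k' → Ω₁` with
`jK ∘ iK = jk ∘ ik`; `K/κ` algebraic (through `iK`), `2 ≤ [F : K]_s` (through `iF`), and `k'` splitting (through
`ik`) the separable closure of `κ` in `F` (through `i₀`).  Then `F ⊗_K Ω₁` (structures `iF`, `jK`) has two distinct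
primes.  This is `exists_two_primes` with the `Algebra`/`IsScalarTower` instances built from the maps — the shape in
which residue-field maps of schemes arrive (`(… .residueFieldMap _).hom.toAlgebra`). [this work] -/
theorem exists_two_primes_of_ringHom {κ K F k' Ω₁ : Type*} [Field κ] [Field K] [Field F] [Field k'] [Field Ω₁]
    (iK : κ →+* K) (iF : K →+* F) (i₀ : κ →+* F) (htower : ∀ x, i₀ x = iF (iK x)) (ik : κ →+* k')
    (jK : K →+* Ω₁) (jk : k' →+* Ω₁) (hcomm : ∀ x, jK (iK x) = jk (ik x))
    (halg : letI := iK.toAlgebra; Algebra.IsAlgebraic κ K)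
    (hsplit : letI := i₀.toAlgebra; letI := ik.toAlgebra;
      ∀ x : separableClosure κ F, ((minpoly κ x).map ik).Splits)
    (h2 : letI := iF.toAlgebra; 2 ≤ Module.finrank K (separableClosure K F)) :
    letI := iF.toAlgebra
    letI := jK.toAlgebra
    ∃ P Q : Ideal (F ⊗[K] Ω₁), P.IsPrime ∧ Q.IsPrime ∧ P ≠ Q := by
  letI := iK.toAlgebra
  letI := iF.toAlgebra
  letI := i₀.toAlgebra
  letI := ik.toAlgebra
  letI := jK.toAlgebra
  letI := jk.toAlgebra
  letI : Algebra κ Ω₁ := (jK.comp iK).toAlgebra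
  haveI : IsScalarTower κ K F := IsScalarTower.of_algebraMap_eq (fun x => htower x)
  haveI : IsScalarTower κ K Ω₁ := IsScalarTower.of_algebraMap_eq (fun _ => rfl)
  haveI : IsScalarTower κ k' Ω₁ := IsScalarTower.of_algebraMap_eq (fun x => hcomm x)
  haveI : Algebra.IsAlgebraic κ K := halg
  exact exists_two_primes κ K F k' Ω₁ hsplit h2

end RingHomForm

end SplitFibre

end Summit.ResolutionOfSingularities.ResolutionOfSingularities.Theorems.NoZeno.ExcCount

end
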